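import Literature.Geometry.Kaehler.ComplexTorusDeRham
import Literature.NumberTheory.Transcendental.ComplexFormsProofs
import HarnessLib

/-!
# Complex de Rham cohomology of a complex torus; invariant forms of type `(p, q)`

Companion of `Literature/Geometry/Kaehler/ComplexTorusDeRham.lean` (Lange–Birkenhake (1992),
Prop. 1.1.20 with real coefficient spaces). Here the coefficients are `ℂ` and the cohomology is
the `ℂ`-vector space `complexDeRhamCohomology E X k` of
`Literature/NumberTheory/Transcendental/ComplexForms.lean` (the one entering Hodge-theoretic
statements such as `hodgePQ`), for the complex torus `X = E/Φ(ℤ^ι)`: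

* `ComplexTorus.cconstClass Φ : Alt^k_ℝ(E; ℂ) →ₗ[ℂ] H^k_dR(X; ℂ)`, `c ↦ [constForm Φ c]`, and the
  average `ComplexTorus.cavgClass` in the other direction (both `ℂ`-linear);
* `ComplexTorus.cconstClassEquiv Φ : Alt^k_ℝ(E; ℂ) ≃ₗ[ℂ] H^k_dR(X; ℂ)` — **Lange–Birkenhake (1992),
  Prop. 1.1.20** verbatim ("`H^n_dR(X) ≅ IF^n(X)`, the complex vector space of invariant
  `n`-forms", `IF^n(X) ≅ Alt^n_ℝ(V, ℂ)`), from `mk_eq_constClass_avg` /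
  `eq_constForm_avg_sub_mextDeriv` and the identification of the `ℂ`-spans
  (`mem_cclosedSmoothForms_iff`, `mem_cexactSmoothForms_succ_iff` of `ComplexFormsProofs`);
* `ComplexTorus.IsConstOfType p q c`: the constant form `c ∈ Alt^k_ℝ(E; ℂ)` has type `(p, q)`
  (weight `p - q` under `v ↦ e^{iθ} v`), `isOfType_constForm_iff`, and
  `ComplexTorus.cconstClass_mem_hodgePQ`: **the class of an invariant form of type `(p, q)` lies
  in `H^{p,q}(X)`** (Lange–Birkenhake (1992), §1.1.5: the invariant forms of type `(p, q)`,
  `IF^{p,q}(X)`, and Thm. 1.1.21 (a), `H^{p,q}(X) ≅ IF^{p,q}`; only the inclusion is recorded).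

## References

* H. Lange, Ch. Birkenhake, *Complex Abelian Varieties*, Grundlehren 302 (1992), Prop. 1.1.20,
  §1.1.5, Thm. 1.1.21. [LangeBirkenhake1992]
-/

noncomputable section

open scoped Manifold ContDiff Topology
open Bundle Set Filter MeasureTheory
open Literature.NumberTheory.Transcendental

namespace Literature.Geometry.Kaehler

namespace ComplexTorus

variable {ι : Type*} [Fintype ι] {E : Type*} [NormedAddCommGroup E] [NormedSpace ℂ E]
  (Φ : (ι → ℝ) ≃L[ℝ] E) {k : ℕ}

/-! ### Complex classes of invariant forms -/

/-- `constForm` commutes with complex scalars. [folklore] -/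
theorem constForm_smul_complex (c : ℂ) (x : E [⋀^Fin k]→L[ℝ] ℂ) :
    constForm Φ (c • x) = c • constForm Φ x :=
  rfl

/-- Invariant complex forms are closed smooth complex forms (`Z^k(X; ℂ)`). [cite: LangeBirkenhake1992, §1.1.4] -/
theorem constForm_mem_cclosedSmoothForms (c : E [⋀^Fin k]→L[ℝ] ℂ) :
    constForm Φ c ∈ cclosedSmoothForms E (ComplexTorus Φ) k :=
  mem_cclosedSmoothForms (isSmoothForm_constForm Φ c) (isClosedForm_constForm Φ c)

/-- **The complex de Rham class of an invariant form**, `c ↦ [constForm Φ c] ∈ H^k_dR(X; ℂ)`, a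
`ℂ`-linear map (Lange–Birkenhake (1992), Prop. 1.1.20, `IF^n(X) → H^n_dR(X)`).
[cite: LangeBirkenhake1992, Prop. 1.1.20] -/
def cconstClass : (E [⋀^Fin k]→L[ℝ] ℂ) →ₗ[ℂ] complexDeRhamCohomology E (ComplexTorus Φ) k where
  toFun c := complexDeRhamCohomology.mk E (ComplexTorus Φ) k
    ⟨constForm Φ c, constForm_mem_cclosedSmoothForms Φ c⟩
  map_add' _ _ := rfl
  map_smul' _ _ := rfl

/-- Unfolding of `cconstClass`. [folklore] -/
theorem cconstClass_apply (c : E [⋀^Fin k]→L[ℝ] ℂ) :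
    cconstClass Φ c = complexDeRhamCohomology.mk E (ComplexTorus Φ) k
      ⟨constForm Φ c, constForm_mem_cclosedSmoothForms Φ c⟩ :=
  rfl

/-- The average is `ℂ`-homogeneous. [folklore] -/
theorem avg_smul_complex (c : ℂ) (β : MForm 𝓘(ℝ, E) (ComplexTorus Φ) ℂ k) :
    avg Φ (c • β) = c • avg Φ β := by
  rw [avg_def, avg_def, ← MeasureTheory.integral_smul]
  rfl

/-- **Exact complex forms have average zero** (`B^k(X; ℂ)` consists of single `dβ`,
`mem_cexactSmoothForms_succ_iff`). [cite: LangeBirkenhake1992, §1.1.4] -/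
theorem avg_eq_zero_of_mem_cexactSmoothForms {α : MForm 𝓘(ℝ, E) (ComplexTorus Φ) ℂ k}
    (hα : α ∈ cexactSmoothForms E (ComplexTorus Φ) k) : avg Φ α = 0 := by
  cases k with
  | zero =>
    have h0 : α = 0 := by simpa [cexactSmoothForms] using hα
    rw [h0, avg_zero]
  | succ k =>
    obtain ⟨β, hβ, rfl⟩ := (mem_cexactSmoothForms_succ_iff α).1 hα
    exact avg_mextDeriv Φ (((isSmoothForm_iff_contDiff_liftForm Φ β).1 hβ).of_le (by simp))

/-- The average as a `ℂ`-linear map on closed smooth complex forms. [folklore] -/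
def cavgₗ : cclosedSmoothForms E (ComplexTorus Φ) k →ₗ[ℂ] (E [⋀^Fin k]→L[ℝ] ℂ) where
  toFun α := avg Φ α
  map_add' α β :=
    avg_add Φ ((isSmoothForm_iff_contDiff_liftForm Φ _).1 ((mem_cclosedSmoothForms_iff _).1 α.2).1).continuous
      ((isSmoothForm_iff_contDiff_liftForm Φ _).1 ((mem_cclosedSmoothForms_iff _).1 β.2).1).continuous
  map_smul' c α := by
    simp only [Submodule.coe_smul, RingHom.id_apply]
    exact avg_smul_complex Φ c α.1

/-- Unfolding of `cavgₗ`. [folklore] -/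
theorem cavgₗ_apply (α : cclosedSmoothForms E (ComplexTorus Φ) k) : cavgₗ Φ α = avg Φ α := rfl

/-- **The average on complex de Rham cohomology**, `[α] ↦ ∫ₓ α ∈ Alt^k_ℝ(E; ℂ)` (`ℂ`-linear).
[cite: LangeBirkenhake1992, Prop. 1.1.20] -/
def cavgClass : complexDeRhamCohomology E (ComplexTorus Φ) k →ₗ[ℂ] (E [⋀^Fin k]→L[ℝ] ℂ) :=
  Submodule.liftQ _ (cavgₗ Φ) fun α hα ↦ by
    rw [LinearMap.mem_ker, cavgₗ_apply]
    exact avg_eq_zero_of_mem_cexactSmoothForms Φ hα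

/-- `cavgClass [α] = avg α`. [folklore] -/
@[simp] theorem cavgClass_mk (α : cclosedSmoothForms E (ComplexTorus Φ) k) :
    cavgClass Φ (complexDeRhamCohomology.mk E (ComplexTorus Φ) k α) = avg Φ α :=
  rfl

/-- `cavgClass ∘ cconstClass = id`. [cite: LangeBirkenhake1992, Prop. 1.1.20] -/
@[simp] theorem cavgClass_cconstClass (c : E [⋀^Fin k]→L[ℝ] ℂ) :
    cavgClass Φ (cconstClass Φ c) = c := by
  rw [cconstClass_apply, cavgClass_mk]
  exact avg_constForm Φ c

variable [FiniteDimensional ℂ E]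

/-- **Every complex de Rham class of the torus is the class of the invariant form given by its
average** (`ℂ` coefficients). [cite: LangeBirkenhake1992, Prop. 1.1.20] -/
theorem cmk_eq_cconstClass_avg (α : cclosedSmoothForms E (ComplexTorus Φ) k) :
    complexDeRhamCohomology.mk E (ComplexTorus Φ) k α =
      cconstClass Φ (avg Φ (α : MForm 𝓘(ℝ, E) (ComplexTorus Φ) ℂ k)) := by
  have hα : (α : MForm 𝓘(ℝ, E) (ComplexTorus Φ) ℂ k) ∈ closedSmoothForms 𝓘(ℝ, E) (ComplexTorus Φ) ℂ k :=
    (mem_cclosedSmoothForms_iff _).1 α.2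
  rw [cconstClass_apply, complexDeRhamCohomology.mk_eq_mk_iff]
  cases k with
  | zero =>
    have h0 : (α : MForm 𝓘(ℝ, E) (ComplexTorus Φ) ℂ 0) = constForm Φ (avg Φ (α : MForm _ _ ℂ 0)) :=
      eq_constForm_avg_zero Φ (⟨_, hα⟩ : closedSmoothForms 𝓘(ℝ, E) (ComplexTorus Φ) ℂ 0)
    change (α : MForm 𝓘(ℝ, E) (ComplexTorus Φ) ℂ 0) - constForm Φ (avg Φ (α : MForm _ _ ℂ 0)) ∈ _
    rw [← h0, sub_self]
    exact Submodule.zero_mem _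
  | succ k =>
    obtain ⟨hsm, heq⟩ := eq_constForm_avg_sub_mextDeriv Φ
      (⟨_, hα⟩ : closedSmoothForms 𝓘(ℝ, E) (ComplexTorus Φ) ℂ (k + 1))
    change (α : MForm 𝓘(ℝ, E) (ComplexTorus Φ) ℂ (k + 1)) -
      constForm Φ (avg Φ (α : MForm _ _ ℂ (k + 1))) ∈ _
    have h2 := (congrArg (fun t ↦ t - constForm Φ (avg Φ (α : MForm _ _ ℂ (k + 1)))) heq).trans
      (sub_sub_cancel_left _ _)
    change (α : MForm 𝓘(ℝ, E) (ComplexTorus Φ) ℂ (k + 1)) - _ = _ at h2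
    rw [h2]
    exact Submodule.neg_mem _ ((mem_cexactSmoothForms_succ_iff _).2 ⟨_, hsm, rfl⟩)

/-- `cconstClass ∘ cavgClass = id`. [cite: LangeBirkenhake1992, Prop. 1.1.20] -/
@[simp] theorem cconstClass_cavgClass (c : complexDeRhamCohomology E (ComplexTorus Φ) k) :
    cconstClass Φ (cavgClass Φ c) = c := by
  obtain ⟨α, rfl⟩ := complexDeRhamCohomology.mk_surjective c
  rw [cavgClass_mk]
  exact (cmk_eq_cconstClass_avg Φ α).symm

/-- **Lange–Birkenhake (1992), Prop. 1.1.20** (complex coefficients): the complex de Rham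
cohomology of the complex torus `X = E/Φ(ℤ^ι)` is the space of invariant complex forms,
`Alt^k_ℝ(E; ℂ) ≃ₗ[ℂ] H^k_dR(X; ℂ)`, `c ↦ [constForm Φ c]`, inverse the average.
[cite: LangeBirkenhake1992, Prop. 1.1.20] -/
def cconstClassEquiv : (E [⋀^Fin k]→L[ℝ] ℂ) ≃ₗ[ℂ] complexDeRhamCohomology E (ComplexTorus Φ) k :=
  LinearEquiv.ofLinear (cconstClass Φ) (cavgClass Φ) (LinearMap.ext (cconstClass_cavgClass Φ))
    (LinearMap.ext (cavgClass_cconstClass Φ))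

/-- `cconstClassEquiv` is `cconstClass`. [folklore] -/
@[simp] theorem cconstClassEquiv_apply (c : E [⋀^Fin k]→L[ℝ] ℂ) :
    cconstClassEquiv Φ c = cconstClass Φ (k := k) c :=
  rfl

/-! ### Invariant forms of type `(p, q)` -/

omit [FiniteDimensional ℂ E] in
/-- The constant complex `k`-form `c` on `E` **has type `(p, q)`**: `p + q = k` and
`c(e^{iθ}v₁, …, e^{iθ}v_k) = e^{i(p-q)θ} c(v₁, …, v_k)` — the pointwise condition `IsOfType` of
`ComplexForms`, for the `U(1)`-action on the vector space `E` (Lange–Birkenhake (1992), §1.1.5: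
the invariant forms of type `(p, q)`, spanned by the `dv_I ∧ dv̄_J`). [cite: LangeBirkenhake1992, §1.1.5] -/
def IsConstOfType (p q : ℕ) (c : E [⋀^Fin k]→L[ℝ] ℂ) : Prop :=
  p + q = k ∧ ∀ (θ : ℝ) (v : Fin k → E),
    c (fun i ↦ Complex.exp (θ * Complex.I) • v i) = Complex.exp (((p : ℤ) - q : ℤ) * θ * Complex.I) * c v

omit [FiniteDimensional ℂ E] in
/-- **An invariant form has type `(p, q)` on the torus iff its value does on `E`** (the
condition is the same at every point). [cite: LangeBirkenhake1992, §1.1.5] -/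
theorem isOfType_constForm_iff {p q : ℕ} (c : E [⋀^Fin k]→L[ℝ] ℂ) :
    IsOfType p q (constForm Φ c) ↔ IsConstOfType p q c := by
  refine ⟨fun h ↦ ⟨h.1, fun θ v ↦ h.2 0 θ v⟩, fun h ↦ ⟨h.1, fun _ θ v ↦ h.2 θ v⟩⟩

omit [FiniteDimensional ℂ E] in
/-- **The class of an invariant form of type `(p, q)` lies in `H^{p,q}(X) ⊆ H^k_dR(X; ℂ)`**
(Lange–Birkenhake (1992), §1.1.5 / Thm. 1.1.21 (a): `IF^{p,q}(X) ⊆ H^{p,q}(X)`; the reverse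
inclusion, i.e. the Hodge decomposition of the torus, is not attempted here).
[cite: LangeBirkenhake1992, Thm. 1.1.21] -/
theorem cconstClass_mem_hodgePQ {p q : ℕ} {c : E [⋀^Fin k]→L[ℝ] ℂ} (hc : IsConstOfType p q c) :
    cconstClass Φ c ∈ hodgePQ E (ComplexTorus Φ) k p q :=
  Submodule.subset_span ⟨⟨constForm Φ c, constForm_mem_cclosedSmoothForms Φ c⟩,
    (isOfType_constForm_iff Φ c).2 hc, rfl⟩

end ComplexTorus

end Literature.Geometry.Kaehler
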